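import Literature.AlgebraicGeometry.Resolution.RelativeCurveSmoothFibreFromJ2
import HarnessLib

/-!
# Temkin's Thm. 3.3.1 (smooth-fibre case): the assembly with disc data threaded

Topic: `Literature/AlgebraicGeometry/Resolution`. M. Temkin, *Inseparable local uniformization*,
J. Algebra 373 (2013) 65–119 = arXiv:0804.1554v3, Thm. 3.3.1 for `k`-smooth generic fibres
(tree: the named fact `Temkin2013RelativeCurveSmoothFibre`, the last leaf of `Temkin2013`).

`Temkin2013RelativeCurveSmoothFibre.of_inputs` (`RelativeCurveSmoothFibreAssembly.lean`) assembles
the fact from its valuative input (J1) — PROVED in the tree (`valuativeInput_J1`,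
`RelativeCurveSmoothFibreFromJ2.lean`) — and its algebraization (J2): the conclusion of
Thm. 3.3.1 for data `(k, K, L₁)` given `k`-separable constants `Y ⊆ L₁^h` and a henselian
generator `x ∈ L₁°`, `L₁ ≤ k(Y)(x)^h`, with the purely inseparable extension of the conclusion
TRIVIAL (`l = k`). The chart construction aimed at (J2) (`RelCurveChart` + `EData`,
`DChartRoof.lean`) needs more than the hypotheses of (J2) provide: a DEEP `m`-rational disc
`|X − a| ≤ |c|` through `x`, `m ⊆ L₁^h` finite separable over `k`, on which the finitely many
relevant algebraic functions converge (Temkin, proof of Thm. 3.3.1, Step 3, resting on Thm. 3.2.6,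
Step 2: "we can choose `l̄` of the form `l̂` for a finite purely inseparable extension `l/k`").
Over the given `k` such a disc need not exist — e.g. `k = 𝔽_p(u)((t))`-like ground fields with
`x = u^{1/p} + w`, `K = L₁ = k(x)`: every `k`-separable `m ⊆ L₁^h` has residue field `𝔽_p(u)`,
and no `m°`-smooth local chart can contain `L₁°` — it exists only after a finite purely
inseparable extension of the constants, i.e. at a deeper LEVEL `S`; and the level is chosen on
the valuative side, BEFORE the algebraization sees the data. This file therefore re-proves the
assembly with an ARBITRARY predicate `Φ Ω V E F t Y` ("the constants `Y` contain disc data for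
the generator `t`, relative to constants `E` and function field `F`") threaded from the valuative
input to the algebraization:

* `Temkin2013RelativeCurveSmoothFibre.of_inputs_with` — **(J1 with Φ) → (J2 assuming Φ) →
  `Temkin2013RelativeCurveSmoothFibre`**: the proof of `of_inputs` verbatim (ambient
  `(Ω, V) = (\overline{K₁}, V ⊇ K₁°)`, the valuative datum `(S, Y, t)`, the level data of
  `exists_smoothFibre_level` over a finite purely inseparable level `lvl ⊇ S`, (J2) for the level
  data, descent), with `Φ Ω V k(S) K₁ t Y` carried along: at the level, `k(S) ≤ lvl = l₀(Ω)` and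
  `K₁ ≤ F₁ = K₁·lvl`, so (J2) receives `Φ` for SOME subfield `E` of its constants and SOME
  subfield `F` of its function field — PROVED;
* `valuativeInputWith_of_provider` — **(J1 with Φ) from (J1) and a provider**: it suffices to
  enlarge the valuative datum `(S, Y, t)` of (J1) to `(S′ ⊇ S, Y′ ⊇ Y, t)` with `Φ` — PROVED;
* `Temkin2013RelativeCurveSmoothFibre.of_discProvider`, `Temkin2013.of_discProvider` — with (J1)
  proved in the tree: **a provider of `Φ` and the algebraization assuming `Φ` close
  `Temkin2013RelativeCurveSmoothFibre` and `Temkin2013`** (Thm. 1.3.2, weak form) — PROVED;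
* `Temkin2013RelativeCurveSmoothFibre.of_algebraization_of_isAlgebraic`,
  `Temkin2013.of_algebraization_of_isAlgebraic` — the case `Φ = ⊤`: **(J2) provers may assume `Ω`
  algebraic over `L₁`** (the assembly applies (J2) inside `\overline{K₁}` only) — PROVED;
* `exists_smoothFibre_level_with_constants` — the alternative for a proof of (J2) AS STATED: the
  level data of `exists_smoothFibre_level` over a level `lvl ⊇ S` together with the data of (J2)
  re-established at the level for the constants `Y` enlarged by finitely many extra constants
  `Y⁺ ⊆ (K₁·k(S))^h` separable over `k(S)` (a level passage INSIDE the proof of (J2), after the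
  elements to be avoided by the disc are known) — PROVED.

The intended instance of `Φ` is the split-disc package of `GeneratorDeepCentres.lean`
(`exists_disc_constants_charP`: centre `a`, radius `c`, the polynomial `P`, all among / over the
constants `Y`, with `|t − a| < |c| < |a − ρ|` for the other roots `ρ` of `P` and the avoidance of
finitely many prescribed algebraic elements), but nothing here depends on that choice: `Φ` only
has to speak about the ambient valued field, the element `t` and finite sets / subfields of `Ω`,
all of which are literally the same before and after the passage to the level.

All statements are [folklore] glue; no definitions, no named facts.

## Sources

* M. Temkin, arXiv:0804.1554v3, Thm. 3.3.1 and its proof, Steps 1–4 (pp. 44–45); Thm. 3.2.6,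
  proof, Step 2 (p. 43); Thm. 1.3.2. [Temkin2013]
-/

noncomputable section

open IsLocalRing

namespace Literature.AlgebraicGeometry.Resolution

universe u

/-! ### The assembly with a threaded predicate -/

set_option maxHeartbeats 1600000 in
set_option synthInstance.maxHeartbeats 80000 in
/-- **Thm. 3.3.1 (smooth-fibre case) from its valuative input and its algebraization, with disc
data `Φ` threaded.** `Φ Ω V E F t Y` is an arbitrary predicate on an ambient valued field
`(Ω, V)`, a subfield of constants `E`, a function field `F`, a generator `t` and a finite set of
constants `Y`. Hypotheses: (J1 with Φ) — the valuative datum `(S, Y, t)` of (J1) together with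
`Φ Ω V k(S) K₁ t Y`; (J2 assuming Φ) — the algebraization (J2) under the extra hypothesis that
`Φ Ω V E F x Y` holds for some subfield `E` of (the image of) the constants `k` and some subfield
`F` of (the image of) `L₁`. Conclusion: `Temkin2013RelativeCurveSmoothFibre`.
[cite: Temkin2013, Thm. 3.3.1 (proof, Steps 1–4) with Thms. 3.2.3, 3.2.4, 3.2.6] -/
theorem Temkin2013RelativeCurveSmoothFibre.of_inputs_with
    (Φ : ∀ (Ω : Type u) [Field Ω], ValuationSubring Ω → Subfield Ω → Subfield Ω → Ω → Finset Ω → Prop)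
    (hJ1 : ∀ (Ω : Type u) [Field Ω] [IsAlgClosed Ω] (V : ValuationSubring Ω) (k K₁ : Subfield Ω),
      k ≤ K₁ → IsRankOneValued V k → ringExpChar (ResidueField V) = ringExpChar Ω →
      FGOver k K₁ → SeparablyGeneratedOver k K₁ →
      (∃ t ∈ K₁, Transcendental k t ∧
        ∀ z ∈ K₁, IsAlgebraic (IntermediateField.adjoin k ({t} : Set Ω)) z) →
      IsValueTorsionOver V k K₁ → IsResiduallyAlgebraicOver V k K₁ →
      IsRankOneValued V K₁ → (∀ z : Ω, IsAlgebraic K₁ z) →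
      ∃ (S Y : Finset Ω) (t : Ω), (∀ s ∈ S, ∃ n : ℕ, s ^ (ringExpChar Ω) ^ n ∈ k) ∧
        (∀ y ∈ Y, IsSeparable (Subfield.closure ((k : Set Ω) ∪ ↑S)) y) ∧
        t ∈ K₁ ⊔ Subfield.closure ((k : Set Ω) ∪ ↑S) ∧ t ∈ V ∧ Transcendental k t ∧
        (↑Y : Set Ω) ⊆ henselization V (K₁ ⊔ Subfield.closure ((k : Set Ω) ∪ ↑S)) ∧
        K₁ ≤ henselization V (Subfield.closure ((k : Set Ω) ∪ ↑S ∪ ↑Y ∪ {t})) ∧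
        Φ Ω V (Subfield.closure ((k : Set Ω) ∪ ↑S)) K₁ t Y)
    (hJ2 : ∀ (k K : Type u) [Field k] [Field K] [Algebra k K]
      (Ok : ValuationSubring k) (O : ValuationSubring K),
      ringChar (ResidueField Ok) = ringChar k →
      O.comap (algebraMap k K) = Ok → ringKrullDim Ok = 1 → ringKrullDim O = 1 →
      (⊤ : IntermediateField k K).FG → Algebra.trdeg k K = 1 →
      IsValueTorsionOver O (algebraMap k K).fieldRange ⊤ →
      IsResiduallyAlgebraicOver O (algebraMap k K).fieldRange ⊤ →
      ∀ A : Subring K, IsAffineNormalizedModel O (Ok.toSubring.map (algebraMap k K)) A →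
      Algebra.Smooth k (Algebra.adjoin k (A : Set K)) →
      ∀ (L₁ : Type u) [Field L₁] [Algebra K L₁] [Algebra k L₁] [IsScalarTower k K L₁],
      FiniteDimensional K L₁ →
      ∀ O₁ : ValuationSubring L₁, O₁.comap (algebraMap K L₁) = O →
      Algebra.Smooth k (Algebra.adjoin k (nrIn (A.map (algebraMap K L₁)) : Set L₁)) →
      ∀ (Ω : Type u) [Field Ω] [IsAlgClosed Ω] [Algebra L₁ Ω] [Algebra K Ω] [Algebra k Ω]
        [IsScalarTower K L₁ Ω] [IsScalarTower k L₁ Ω] [IsScalarTower k K Ω]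
        (V : ValuationSubring Ω), V.comap (algebraMap L₁ Ω) = O₁ →
      (∀ z : Ω, IsAlgebraic L₁ z) →
      ∀ (Y : Finset Ω), (∀ y ∈ Y, IsSeparable k y) →
        (↑Y : Set Ω) ⊆ henselization V (algebraMap L₁ Ω).fieldRange →
      ∀ x : L₁, x ∈ O₁ → Transcendental k (algebraMap L₁ Ω x) →
        (algebraMap L₁ Ω).fieldRange ≤ henselization V
          (Subfield.closure (Set.range (algebraMap k Ω) ∪ ↑Y ∪ {algebraMap L₁ Ω x})) →
      ∀ (E F : Subfield Ω), (E : Set Ω) ⊆ Set.range (algebraMap k Ω) →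
        F ≤ (algebraMap L₁ Ω).fieldRange → Φ Ω V E F (algebraMap L₁ Ω x) Y →
      Temkin2013RelativeCurveConclusion k K Ok O A L₁ O₁) :
    Temkin2013RelativeCurveSmoothFibre.{u} := by
  intro k K _ _ _ Ok O hchar hOk hdimk hdimK hfg htr hvt hra A hA hsm K₁ _ _ _ _ hK₁fin O₁ hO₁ hsm₁
  classical
  haveI := hK₁fin
  ------------------------------------------------------------------
  -- ### the ambient valued field `(Ω, V) = (\overline{K₁}, V ⊇ K₁°)`
  ------------------------------------------------------------------
  let Ω : Type u := AlgebraicClosure K₁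
  obtain ⟨V, hV⟩ := exists_valuationSubring_comap_eq (Ω := Ω) O₁
  haveI : IsScalarTower k K Ω := IsScalarTower.of_algebraMap_eq fun c => by
    rw [IsScalarTower.algebraMap_apply k K₁ Ω, IsScalarTower.algebraMap_apply k K K₁,
      ← IsScalarTower.algebraMap_apply K K₁ Ω]
  -- the hypotheses in the ambient rendering
  obtain ⟨hle, hFG, hVT, hRA, hr1k, hr1K₁, hSG, hchΩ, htΩ⟩ :=
    smoothFibre_ambient_hypotheses k K Ok O hchar hOk hdimk hdimK hfg htr hvt hra A hA K₁ O₁ hO₁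
      hsm₁ Ω V hV
  -- `Ω = \overline{K₁}` is algebraic over (the image of) `K₁`
  have halgΩ : ∀ z : Ω, IsAlgebraic (algebraMap K₁ Ω).fieldRange z := fun z =>
    (Algebra.IsAlgebraic.isAlgebraic (R := K₁) z).ringHom_of_comp_eq
      (algebraMap K₁ Ω).rangeRestrictField (RingHom.id Ω)
      (algebraMap K₁ Ω).rangeRestrictField_bijective.1 (by ext; rfl)
  ------------------------------------------------------------------
  -- ### (J1 with Φ): the finite-level valuative datum and the disc data
  ------------------------------------------------------------------
  obtain ⟨S, Y, t, hSpi, hYsep, htK, htV, httr, hYh, hgen, hΦ⟩ :=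
    hJ1 Ω V (algebraMap k Ω).fieldRange (algebraMap K₁ Ω).fieldRange hle hr1k hchΩ hFG hSG htΩ
      hVT hRA hr1K₁ halgΩ
  -- `S` lies in the perfect closure of `k`
  have hSpc : (↑S : Set Ω) ⊆ perfectClosure k Ω := by
    intro s hs
    obtain ⟨n, hn⟩ := hSpi s hs
    haveI : ExpChar k (ringExpChar k) := inferInstance
    haveI : ExpChar Ω (ringExpChar k) :=
      expChar_of_injective_algebraMap (algebraMap k Ω).injective (ringExpChar k)
    have hq : ringExpChar Ω = ringExpChar k := ringExpChar.eq Ω (ringExpChar k)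
    rw [hq] at hn
    exact (mem_perfectClosure_iff_pow_mem (ringExpChar k)).mpr ⟨n, hn⟩
  ------------------------------------------------------------------
  -- ### the level data (Step 1)
  ------------------------------------------------------------------
  obtain ⟨lvl, hSlvl, hlvlk, hlvlfin, FE, FE₁, hFE, hFE₁, hFEle, iKFE, iTk, iK₁FE₁, iTk₁, iKFE₁,
    iT₁, hψ, hψ₁, hTfin, hFfin, hFpi, hF₁fin, hF₁pi, l₀, hl₀mem, hl₀fin, hl₀pi, hFgen, hF₁gen,
    A_F, hAA_F, hrest⟩ :=
    exists_smoothFibre_level k K Ok O hchar hOk hdimk hdimK hfg htr hvt hra A hA K₁ O₁ hO₁ Ω V hV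
      S hSpc
  letI := iKFE; letI := iK₁FE₁; letI := iKFE₁
  haveI := iTk; haveI := iTk₁; haveI := iT₁
  letI iFF₁ : Algebra FE FE₁ := (IntermediateField.inclusion hFEle).toRingHom.toAlgebra
  obtain ⟨iT₂, h10⟩ := hTfin
  haveI := iT₂; haveI := h10; haveI := hFfin; haveI := hFpi; haveI := hF₁fin; haveI := hF₁pi
  haveI := hl₀fin; haveI := hl₀pi
  obtain ⟨hO_F₁K₁, hO_FK, hO_Feq, hOk', h1, h3, h4, h5, h6, h7, h8, h9, hsmF, hsmF₁, htransport⟩ :=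
    hrest
  -- instances towards `Ω`
  haveI : IsScalarTower FE FE₁ Ω := IsScalarTower.of_algebraMap_eq fun _ => rfl
  haveI : IsScalarTower l₀ FE₁ Ω := IsScalarTower.of_algebraMap_eq fun _ => rfl
  haveI : IsScalarTower l₀ FE Ω := IsScalarTower.of_algebraMap_eq fun _ => rfl
  -- the image of `l₀` in `Ω` is `lvl`
  have hl₀range : Set.range (algebraMap l₀ Ω) = (lvl : Set Ω) := by
    ext z
    constructor
    · rintro ⟨c, rfl⟩
      exact (hl₀mem (c : FE)).mp c.2
    · intro hz
      have hzFE : z ∈ FE := by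
        rw [hFE]; exact (le_sup_right : lvl ≤ _ ⊔ lvl) hz
      exact ⟨⟨⟨z, hzFE⟩, (hl₀mem _).mpr hz⟩, rfl⟩
  -- `kΩ ∪ S ⊆ lvl`, so `k(S) ≤ lvl`
  have hkS_lvl : Subfield.closure (((algebraMap k Ω).fieldRange : Set Ω) ∪ ↑S) ≤ lvl.toSubfield := by
    refine Subfield.closure_le.mpr (Set.union_subset ?_ hSlvl)
    rintro _ ⟨c, rfl⟩
    exact lvl.algebraMap_mem c
  -- the range of `F₁ = K₁·lvl` in `Ω`
  have hF₁range : (algebraMap FE₁ Ω).fieldRange = FE₁.toSubfield :=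
    fieldRange_algebraMap_intermediateField FE₁
  have hK₁FE₁ : (algebraMap K₁ Ω).fieldRange ≤ FE₁.toSubfield := by
    rintro _ ⟨z, rfl⟩
    rw [hFE₁]
    exact (le_sup_left : (IsScalarTower.toAlgHom k K₁ Ω).fieldRange ≤ _) ⟨z, rfl⟩
  have hlvlFE₁ : lvl ≤ FE₁ := by rw [hFE₁]; exact le_sup_right
  ------------------------------------------------------------------
  -- ### the hypotheses of (J2) for the level data
  ------------------------------------------------------------------
  -- the constants are separable over `l₀`
  have hYsep' : ∀ y ∈ Y, IsSeparable l₀ y := fun y hy =>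
    isSeparable_of_subfield_le_range l₀ _ (fun z hz => by
      rw [hl₀range]; exact hkS_lvl hz) (hYsep y hy)
  -- the constants lie in the henselization of `F₁`
  have hYh' : (↑Y : Set Ω) ⊆ henselization V (algebraMap FE₁ Ω).fieldRange := by
    rw [hF₁range]
    refine hYh.trans (henselization_mono V Kuhlmann2010HenselizationIsHenselian_holds.{u} ?_)
    exact sup_le hK₁FE₁ (hkS_lvl.trans fun z hz => hlvlFE₁ hz)
  -- the generator `t` as an element of `F₁°`
  have htFE₁ : t ∈ FE₁ := by
    have : (algebraMap K₁ Ω).fieldRange ⊔ Subfield.closure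
        (((algebraMap k Ω).fieldRange : Set Ω) ∪ ↑S) ≤ FE₁.toSubfield :=
      sup_le hK₁FE₁ (hkS_lvl.trans fun z hz => hlvlFE₁ hz)
    exact this htK
  let x : FE₁ := ⟨t, htFE₁⟩
  have hxΩ : algebraMap FE₁ Ω x = t := rfl
  have hxO : x ∈ V.comap (algebraMap FE₁ Ω) := htV
  -- `t` is transcendental over `l₀`
  have hxtr : Transcendental l₀ (algebraMap FE₁ Ω x) := by
    rw [hxΩ]
    intro halg
    apply httr
    -- algebraic over `l₀` ⇒ over `lvl` ⇒ over `kΩ` (`lvl` is algebraic over `k`)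
    have h1' : IsAlgebraic lvl.toSubfield t :=
      isAlgebraic_subfield_of_range_eq l₀ lvl.toSubfield hl₀range halg
    have hlvlalg : ∀ w ∈ lvl.toSubfield, IsAlgebraic (algebraMap k Ω).fieldRange w := by
      intro w hw
      haveI : Algebra.IsIntegral k (perfectClosure k Ω) := IsPurelyInseparable.isIntegral
      have hw' : IsAlgebraic k w :=
        ((Algebra.IsIntegral.isIntegral (R := k) (⟨w, hlvlk hw⟩ : perfectClosure k Ω)).map
          (IntermediateField.val _)).isAlgebraic
      exact hw'.ringHom_of_comp_eq (algebraMap k Ω).rangeRestrictField (RingHom.id Ω)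
        (algebraMap k Ω).rangeRestrictField_bijective.1 (by ext; rfl)
    have hkl : (algebraMap k Ω).fieldRange ≤ lvl.toSubfield := by
      rintro _ ⟨c, rfl⟩; exact lvl.algebraMap_mem c
    exact isAlgebraic_trans_subfield hkl hlvlalg h1'
  -- the E-side inclusion `F₁ ≤ l₀(Y)(t)^h`
  have hE : (algebraMap FE₁ Ω).fieldRange ≤ henselization V
      (Subfield.closure (Set.range (algebraMap l₀ Ω) ∪ ↑Y ∪ {algebraMap FE₁ Ω x})) := by
    rw [hF₁range, hxΩ, hl₀range]
    have hFE₁eq : FE₁.toSubfield = (algebraMap K₁ Ω).fieldRange ⊔ lvl.toSubfield := by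
      apply le_antisymm
      · intro z hz
        rw [hFE₁] at hz
        -- `z ∈ χ₁.fieldRange ⊔ lvl` as intermediate fields
        have : (IsScalarTower.toAlgHom k K₁ Ω).fieldRange ⊔ lvl ≤
            ((algebraMap K₁ Ω).fieldRange ⊔ lvl.toSubfield).toIntermediateField
              (fun c => (le_sup_right : lvl.toSubfield ≤ _) (lvl.algebraMap_mem c)) := by
          refine sup_le ?_ ?_
          · rintro _ ⟨w, rfl⟩
            exact (le_sup_left : (algebraMap K₁ Ω).fieldRange ≤ _) ⟨w, rfl⟩
          · intro w hw
            exact (le_sup_right : lvl.toSubfield ≤ _) hw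
        exact this hz
      · exact sup_le hK₁FE₁ fun z hz => hlvlFE₁ hz
    rw [hFE₁eq]
    refine sup_le ?_ ?_
    · refine hgen.trans (henselization_mono V Kuhlmann2010HenselizationIsHenselian_holds.{u}
        (Subfield.closure_mono ?_))
      refine Set.union_subset_union_left _ (Set.union_subset_union_left _ ?_)
      intro z hz
      exact hkS_lvl (Subfield.subset_closure hz)
    · intro z hz
      exact le_henselization V _ (Subfield.subset_closure (Or.inl (Or.inl hz)))
  -- the disc data: `k(S) ⊆ lvl = l₀(Ω)` and `K₁ ≤ F₁`
  have hEΦ : ((Subfield.closure (((algebraMap k Ω).fieldRange : Set Ω) ∪ ↑S) : Subfield Ω) : Set Ω) ⊆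
      Set.range (algebraMap l₀ Ω) := by
    rw [hl₀range]
    exact fun z hz => hkS_lvl hz
  have hFΦ : (algebraMap K₁ Ω).fieldRange ≤ (algebraMap FE₁ Ω).fieldRange := by
    rw [hF₁range]; exact hK₁FE₁
  -- `Ω` is algebraic over `F₁ ⊇ K₁`
  haveI : IsScalarTower K₁ FE₁ Ω := IsScalarTower.of_algebraMap_eq fun z => (hψ₁ z).symm
  have halgFE₁ : ∀ z : Ω, IsAlgebraic FE₁ z := fun z =>
    (Algebra.IsAlgebraic.isAlgebraic (R := K₁) z).extendScalars (algebraMap K₁ FE₁).injective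
  ------------------------------------------------------------------
  -- ### (J2) for the level data, and the descent of the conclusion
  ------------------------------------------------------------------
  have hconc : Temkin2013RelativeCurveConclusion l₀ FE
      (((V.comap (algebraMap FE₁ Ω)).comap (algebraMap FE FE₁)).comap (algebraMap l₀ FE))
      ((V.comap (algebraMap FE₁ Ω)).comap (algebraMap FE FE₁)) A_F FE₁
      (V.comap (algebraMap FE₁ Ω)) :=
    hJ2 l₀ FE _ _ h1 rfl h3 h4 h5 h6 h7 h8 A_F h9 hsmF FE₁ h10 _ rfl hsmF₁ Ω V rfl halgFE₁ Y hYsep'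
      hYh' x hxO hxtr hE _ _ hEΦ hFΦ (hxΩ ▸ hΦ)
  exact htransport hconc

/-! ### (J1 with Φ) from (J1) and a provider -/

/-- **Enlarging the valuative datum.** If every valuative datum `(S, Y, t)` of (J1) can be
enlarged to `(S′ ⊇ S, Y′ ⊇ Y, t)` — `S′` still purely inseparable over `k`, `Y′` separable over
`k(S′)` inside `(K₁·k(S′))^h` — so that `Φ Ω V k(S′) K₁ t Y′` holds, then (J1) implies
(J1 with Φ): the remaining clauses of the datum are monotone in `(S, Y)`. [folklore] -/
theorem valuativeInputWith_of_provider
    (Φ : ∀ (Ω : Type u) [Field Ω], ValuationSubring Ω → Subfield Ω → Subfield Ω → Ω → Finset Ω → Prop)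
    (hJ1 : ∀ (Ω : Type u) [Field Ω] [IsAlgClosed Ω] (V : ValuationSubring Ω) (k K₁ : Subfield Ω),
      k ≤ K₁ → IsRankOneValued V k → ringExpChar (ResidueField V) = ringExpChar Ω →
      FGOver k K₁ → SeparablyGeneratedOver k K₁ →
      (∃ t ∈ K₁, Transcendental k t ∧
        ∀ z ∈ K₁, IsAlgebraic (IntermediateField.adjoin k ({t} : Set Ω)) z) →
      IsValueTorsionOver V k K₁ → IsResiduallyAlgebraicOver V k K₁ →
      ∃ (S Y : Finset Ω) (t : Ω), (∀ s ∈ S, ∃ n : ℕ, s ^ (ringExpChar Ω) ^ n ∈ k) ∧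
        (∀ y ∈ Y, IsSeparable (Subfield.closure ((k : Set Ω) ∪ ↑S)) y) ∧
        t ∈ K₁ ⊔ Subfield.closure ((k : Set Ω) ∪ ↑S) ∧ t ∈ V ∧ Transcendental k t ∧
        (↑Y : Set Ω) ⊆ henselization V (K₁ ⊔ Subfield.closure ((k : Set Ω) ∪ ↑S)) ∧
        K₁ ≤ henselization V (Subfield.closure ((k : Set Ω) ∪ ↑S ∪ ↑Y ∪ {t})))
    (hP : ∀ (Ω : Type u) [Field Ω] [IsAlgClosed Ω] (V : ValuationSubring Ω) (k K₁ : Subfield Ω),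
      k ≤ K₁ → IsRankOneValued V k → ringExpChar (ResidueField V) = ringExpChar Ω →
      FGOver k K₁ → SeparablyGeneratedOver k K₁ →
      (∃ t ∈ K₁, Transcendental k t ∧
        ∀ z ∈ K₁, IsAlgebraic (IntermediateField.adjoin k ({t} : Set Ω)) z) →
      IsValueTorsionOver V k K₁ → IsResiduallyAlgebraicOver V k K₁ →
      IsRankOneValued V K₁ → (∀ z : Ω, IsAlgebraic K₁ z) →
      ∀ (S Y : Finset Ω) (t : Ω), (∀ s ∈ S, ∃ n : ℕ, s ^ (ringExpChar Ω) ^ n ∈ k) →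
        (∀ y ∈ Y, IsSeparable (Subfield.closure ((k : Set Ω) ∪ ↑S)) y) →
        t ∈ K₁ ⊔ Subfield.closure ((k : Set Ω) ∪ ↑S) → t ∈ V → Transcendental k t →
        (↑Y : Set Ω) ⊆ henselization V (K₁ ⊔ Subfield.closure ((k : Set Ω) ∪ ↑S)) →
        K₁ ≤ henselization V (Subfield.closure ((k : Set Ω) ∪ ↑S ∪ ↑Y ∪ {t})) →
      ∃ (S' Y' : Finset Ω), S ⊆ S' ∧ Y ⊆ Y' ∧ (∀ s ∈ S', ∃ n : ℕ, s ^ (ringExpChar Ω) ^ n ∈ k) ∧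
        (∀ y ∈ Y', IsSeparable (Subfield.closure ((k : Set Ω) ∪ ↑S')) y) ∧
        (↑Y' : Set Ω) ⊆ henselization V (K₁ ⊔ Subfield.closure ((k : Set Ω) ∪ ↑S')) ∧
        Φ Ω V (Subfield.closure ((k : Set Ω) ∪ ↑S')) K₁ t Y') :
    ∀ (Ω : Type u) [Field Ω] [IsAlgClosed Ω] (V : ValuationSubring Ω) (k K₁ : Subfield Ω),
      k ≤ K₁ → IsRankOneValued V k → ringExpChar (ResidueField V) = ringExpChar Ω →
      FGOver k K₁ → SeparablyGeneratedOver k K₁ →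
      (∃ t ∈ K₁, Transcendental k t ∧
        ∀ z ∈ K₁, IsAlgebraic (IntermediateField.adjoin k ({t} : Set Ω)) z) →
      IsValueTorsionOver V k K₁ → IsResiduallyAlgebraicOver V k K₁ →
      IsRankOneValued V K₁ → (∀ z : Ω, IsAlgebraic K₁ z) →
      ∃ (S Y : Finset Ω) (t : Ω), (∀ s ∈ S, ∃ n : ℕ, s ^ (ringExpChar Ω) ^ n ∈ k) ∧
        (∀ y ∈ Y, IsSeparable (Subfield.closure ((k : Set Ω) ∪ ↑S)) y) ∧
        t ∈ K₁ ⊔ Subfield.closure ((k : Set Ω) ∪ ↑S) ∧ t ∈ V ∧ Transcendental k t ∧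
        (↑Y : Set Ω) ⊆ henselization V (K₁ ⊔ Subfield.closure ((k : Set Ω) ∪ ↑S)) ∧
        K₁ ≤ henselization V (Subfield.closure ((k : Set Ω) ∪ ↑S ∪ ↑Y ∪ {t})) ∧
        Φ Ω V (Subfield.closure ((k : Set Ω) ∪ ↑S)) K₁ t Y := by
  intro Ω _ _ V k K₁ hkK₁ hr1 hchar hfg hsg h1 hvt hra hr1K₁ halg
  obtain ⟨S, Y, t, hSpi, hYsep, htK, htV, httr, hYh, hgen⟩ :=
    hJ1 Ω V k K₁ hkK₁ hr1 hchar hfg hsg h1 hvt hra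
  obtain ⟨S', Y', hSS', hYY', hS'pi, hY'sep, hY'h, hΦ⟩ :=
    hP Ω V k K₁ hkK₁ hr1 hchar hfg hsg h1 hvt hra hr1K₁ halg S Y t hSpi hYsep htK htV httr hYh hgen
  have hhens := Kuhlmann2010HenselizationIsHenselian_holds.{u}
  -- monotonicity of the closures in `S`
  have hcl : Subfield.closure ((k : Set Ω) ∪ ↑S) ≤ Subfield.closure ((k : Set Ω) ∪ ↑S') :=
    Subfield.closure_mono (Set.union_subset_union_right _ (Finset.coe_subset.mpr hSS'))
  refine ⟨S', Y', t, hS'pi, hY'sep, ?_, htV, httr, hY'h, ?_, hΦ⟩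
  · exact (sup_le_sup_left hcl K₁) htK
  · refine hgen.trans (henselization_mono V hhens (Subfield.closure_mono ?_))
    refine Set.union_subset_union_left _ (Set.union_subset_union ?_ (Finset.coe_subset.mpr hYY'))
    exact Set.union_subset_union_right _ (Finset.coe_subset.mpr hSS')

/-! ### Closing `Temkin2013RelativeCurveSmoothFibre` and `Temkin2013` from a provider -/

/-- **`Temkin2013RelativeCurveSmoothFibre` from a disc provider and the algebraization assuming
the disc data.** With (J1) proved in the tree (`valuativeInput_J1`), Thm. 3.3.1 (smooth-fibre
case) follows from: a PROVIDER enlarging any valuative datum `(S, Y, t)` so that `Φ` holds (the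
valuation theory of the deep split disc at a finite purely inseparable level, Temkin's Thm. 3.2.6,
Step 2), and the ALGEBRAIZATION (J2) under the extra hypothesis `Φ` (the charts, Temkin's
Steps 3–4). [cite: Temkin2013, Thm. 3.3.1 (proof, Steps 1–4) with Thm. 3.2.6] -/
theorem Temkin2013RelativeCurveSmoothFibre.of_discProvider
    (Φ : ∀ (Ω : Type u) [Field Ω], ValuationSubring Ω → Subfield Ω → Subfield Ω → Ω → Finset Ω → Prop)
    (hP : ∀ (Ω : Type u) [Field Ω] [IsAlgClosed Ω] (V : ValuationSubring Ω) (k K₁ : Subfield Ω),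
      k ≤ K₁ → IsRankOneValued V k → ringExpChar (ResidueField V) = ringExpChar Ω →
      FGOver k K₁ → SeparablyGeneratedOver k K₁ →
      (∃ t ∈ K₁, Transcendental k t ∧
        ∀ z ∈ K₁, IsAlgebraic (IntermediateField.adjoin k ({t} : Set Ω)) z) →
      IsValueTorsionOver V k K₁ → IsResiduallyAlgebraicOver V k K₁ →
      IsRankOneValued V K₁ → (∀ z : Ω, IsAlgebraic K₁ z) →
      ∀ (S Y : Finset Ω) (t : Ω), (∀ s ∈ S, ∃ n : ℕ, s ^ (ringExpChar Ω) ^ n ∈ k) →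
        (∀ y ∈ Y, IsSeparable (Subfield.closure ((k : Set Ω) ∪ ↑S)) y) →
        t ∈ K₁ ⊔ Subfield.closure ((k : Set Ω) ∪ ↑S) → t ∈ V → Transcendental k t →
        (↑Y : Set Ω) ⊆ henselization V (K₁ ⊔ Subfield.closure ((k : Set Ω) ∪ ↑S)) →
        K₁ ≤ henselization V (Subfield.closure ((k : Set Ω) ∪ ↑S ∪ ↑Y ∪ {t})) →
      ∃ (S' Y' : Finset Ω), S ⊆ S' ∧ Y ⊆ Y' ∧ (∀ s ∈ S', ∃ n : ℕ, s ^ (ringExpChar Ω) ^ n ∈ k) ∧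
        (∀ y ∈ Y', IsSeparable (Subfield.closure ((k : Set Ω) ∪ ↑S')) y) ∧
        (↑Y' : Set Ω) ⊆ henselization V (K₁ ⊔ Subfield.closure ((k : Set Ω) ∪ ↑S')) ∧
        Φ Ω V (Subfield.closure ((k : Set Ω) ∪ ↑S')) K₁ t Y')
    (hJ2 : ∀ (k K : Type u) [Field k] [Field K] [Algebra k K]
      (Ok : ValuationSubring k) (O : ValuationSubring K),
      ringChar (ResidueField Ok) = ringChar k →
      O.comap (algebraMap k K) = Ok → ringKrullDim Ok = 1 → ringKrullDim O = 1 →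
      (⊤ : IntermediateField k K).FG → Algebra.trdeg k K = 1 →
      IsValueTorsionOver O (algebraMap k K).fieldRange ⊤ →
      IsResiduallyAlgebraicOver O (algebraMap k K).fieldRange ⊤ →
      ∀ A : Subring K, IsAffineNormalizedModel O (Ok.toSubring.map (algebraMap k K)) A →
      Algebra.Smooth k (Algebra.adjoin k (A : Set K)) →
      ∀ (L₁ : Type u) [Field L₁] [Algebra K L₁] [Algebra k L₁] [IsScalarTower k K L₁],
      FiniteDimensional K L₁ →
      ∀ O₁ : ValuationSubring L₁, O₁.comap (algebraMap K L₁) = O →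
      Algebra.Smooth k (Algebra.adjoin k (nrIn (A.map (algebraMap K L₁)) : Set L₁)) →
      ∀ (Ω : Type u) [Field Ω] [IsAlgClosed Ω] [Algebra L₁ Ω] [Algebra K Ω] [Algebra k Ω]
        [IsScalarTower K L₁ Ω] [IsScalarTower k L₁ Ω] [IsScalarTower k K Ω]
        (V : ValuationSubring Ω), V.comap (algebraMap L₁ Ω) = O₁ →
      (∀ z : Ω, IsAlgebraic L₁ z) →
      ∀ (Y : Finset Ω), (∀ y ∈ Y, IsSeparable k y) →
        (↑Y : Set Ω) ⊆ henselization V (algebraMap L₁ Ω).fieldRange →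
      ∀ x : L₁, x ∈ O₁ → Transcendental k (algebraMap L₁ Ω x) →
        (algebraMap L₁ Ω).fieldRange ≤ henselization V
          (Subfield.closure (Set.range (algebraMap k Ω) ∪ ↑Y ∪ {algebraMap L₁ Ω x})) →
      ∀ (E F : Subfield Ω), (E : Set Ω) ⊆ Set.range (algebraMap k Ω) →
        F ≤ (algebraMap L₁ Ω).fieldRange → Φ Ω V E F (algebraMap L₁ Ω x) Y →
      Temkin2013RelativeCurveConclusion k K Ok O A L₁ O₁) :
    Temkin2013RelativeCurveSmoothFibre.{u} :=
  Temkin2013RelativeCurveSmoothFibre.of_inputs_with Φ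
    (valuativeInputWith_of_provider Φ valuativeInput_J1 hP) hJ2

/-- **`Temkin2013` (Thm. 1.3.2, weak absolute form) from a disc provider and the algebraization
assuming the disc data** (through `Temkin2013.of_smoothFibre`).
[cite: Temkin2013, Thm. 1.3.2 with Thm. 3.3.1] -/
theorem Temkin2013.of_discProvider
    (Φ : ∀ (Ω : Type u) [Field Ω], ValuationSubring Ω → Subfield Ω → Subfield Ω → Ω → Finset Ω → Prop)
    (hP : ∀ (Ω : Type u) [Field Ω] [IsAlgClosed Ω] (V : ValuationSubring Ω) (k K₁ : Subfield Ω),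
      k ≤ K₁ → IsRankOneValued V k → ringExpChar (ResidueField V) = ringExpChar Ω →
      FGOver k K₁ → SeparablyGeneratedOver k K₁ →
      (∃ t ∈ K₁, Transcendental k t ∧
        ∀ z ∈ K₁, IsAlgebraic (IntermediateField.adjoin k ({t} : Set Ω)) z) →
      IsValueTorsionOver V k K₁ → IsResiduallyAlgebraicOver V k K₁ →
      IsRankOneValued V K₁ → (∀ z : Ω, IsAlgebraic K₁ z) →
      ∀ (S Y : Finset Ω) (t : Ω), (∀ s ∈ S, ∃ n : ℕ, s ^ (ringExpChar Ω) ^ n ∈ k) →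
        (∀ y ∈ Y, IsSeparable (Subfield.closure ((k : Set Ω) ∪ ↑S)) y) →
        t ∈ K₁ ⊔ Subfield.closure ((k : Set Ω) ∪ ↑S) → t ∈ V → Transcendental k t →
        (↑Y : Set Ω) ⊆ henselization V (K₁ ⊔ Subfield.closure ((k : Set Ω) ∪ ↑S)) →
        K₁ ≤ henselization V (Subfield.closure ((k : Set Ω) ∪ ↑S ∪ ↑Y ∪ {t})) →
      ∃ (S' Y' : Finset Ω), S ⊆ S' ∧ Y ⊆ Y' ∧ (∀ s ∈ S', ∃ n : ℕ, s ^ (ringExpChar Ω) ^ n ∈ k) ∧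
        (∀ y ∈ Y', IsSeparable (Subfield.closure ((k : Set Ω) ∪ ↑S')) y) ∧
        (↑Y' : Set Ω) ⊆ henselization V (K₁ ⊔ Subfield.closure ((k : Set Ω) ∪ ↑S')) ∧
        Φ Ω V (Subfield.closure ((k : Set Ω) ∪ ↑S')) K₁ t Y')
    (hJ2 : ∀ (k K : Type u) [Field k] [Field K] [Algebra k K]
      (Ok : ValuationSubring k) (O : ValuationSubring K),
      ringChar (ResidueField Ok) = ringChar k →
      O.comap (algebraMap k K) = Ok → ringKrullDim Ok = 1 → ringKrullDim O = 1 →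
      (⊤ : IntermediateField k K).FG → Algebra.trdeg k K = 1 →
      IsValueTorsionOver O (algebraMap k K).fieldRange ⊤ →
      IsResiduallyAlgebraicOver O (algebraMap k K).fieldRange ⊤ →
      ∀ A : Subring K, IsAffineNormalizedModel O (Ok.toSubring.map (algebraMap k K)) A →
      Algebra.Smooth k (Algebra.adjoin k (A : Set K)) →
      ∀ (L₁ : Type u) [Field L₁] [Algebra K L₁] [Algebra k L₁] [IsScalarTower k K L₁],
      FiniteDimensional K L₁ →
      ∀ O₁ : ValuationSubring L₁, O₁.comap (algebraMap K L₁) = O →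
      Algebra.Smooth k (Algebra.adjoin k (nrIn (A.map (algebraMap K L₁)) : Set L₁)) →
      ∀ (Ω : Type u) [Field Ω] [IsAlgClosed Ω] [Algebra L₁ Ω] [Algebra K Ω] [Algebra k Ω]
        [IsScalarTower K L₁ Ω] [IsScalarTower k L₁ Ω] [IsScalarTower k K Ω]
        (V : ValuationSubring Ω), V.comap (algebraMap L₁ Ω) = O₁ →
      (∀ z : Ω, IsAlgebraic L₁ z) →
      ∀ (Y : Finset Ω), (∀ y ∈ Y, IsSeparable k y) →
        (↑Y : Set Ω) ⊆ henselization V (algebraMap L₁ Ω).fieldRange →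
      ∀ x : L₁, x ∈ O₁ → Transcendental k (algebraMap L₁ Ω x) →
        (algebraMap L₁ Ω).fieldRange ≤ henselization V
          (Subfield.closure (Set.range (algebraMap k Ω) ∪ ↑Y ∪ {algebraMap L₁ Ω x})) →
      ∀ (E F : Subfield Ω), (E : Set Ω) ⊆ Set.range (algebraMap k Ω) →
        F ≤ (algebraMap L₁ Ω).fieldRange → Φ Ω V E F (algebraMap L₁ Ω x) Y →
      Temkin2013RelativeCurveConclusion k K Ok O A L₁ O₁) :
    Temkin2013.{u} :=
  Temkin2013.of_smoothFibre (Temkin2013RelativeCurveSmoothFibre.of_discProvider Φ hP hJ2)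

/-! ### (J2) provers may assume `Ω` algebraic over `L₁` -/

/-- **(J2) with `Ω` algebraic over `L₁` suffices.** The algebraization (J2) of
`Temkin2013RelativeCurveSmoothFibre.of_algebraization`, weakened by the extra hypothesis that the
ambient algebraically closed field `Ω` is algebraic over `L₁` (so that `(Ω, V)` has rank one and
the radii of `k`-algebraic elements are dense), already implies
`Temkin2013RelativeCurveSmoothFibre`: the assembly only ever applies (J2) inside `\overline{K₁}`.
[cite: Temkin2013, Thm. 3.3.1 (proof, Steps 1–4)] -/
theorem Temkin2013RelativeCurveSmoothFibre.of_algebraization_of_isAlgebraic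
    (hJ2 : ∀ (k K : Type u) [Field k] [Field K] [Algebra k K]
      (Ok : ValuationSubring k) (O : ValuationSubring K),
      ringChar (ResidueField Ok) = ringChar k →
      O.comap (algebraMap k K) = Ok → ringKrullDim Ok = 1 → ringKrullDim O = 1 →
      (⊤ : IntermediateField k K).FG → Algebra.trdeg k K = 1 →
      IsValueTorsionOver O (algebraMap k K).fieldRange ⊤ →
      IsResiduallyAlgebraicOver O (algebraMap k K).fieldRange ⊤ →
      ∀ A : Subring K, IsAffineNormalizedModel O (Ok.toSubring.map (algebraMap k K)) A →
      Algebra.Smooth k (Algebra.adjoin k (A : Set K)) →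
      ∀ (L₁ : Type u) [Field L₁] [Algebra K L₁] [Algebra k L₁] [IsScalarTower k K L₁],
      FiniteDimensional K L₁ →
      ∀ O₁ : ValuationSubring L₁, O₁.comap (algebraMap K L₁) = O →
      Algebra.Smooth k (Algebra.adjoin k (nrIn (A.map (algebraMap K L₁)) : Set L₁)) →
      ∀ (Ω : Type u) [Field Ω] [IsAlgClosed Ω] [Algebra L₁ Ω] [Algebra K Ω] [Algebra k Ω]
        [IsScalarTower K L₁ Ω] [IsScalarTower k L₁ Ω] [IsScalarTower k K Ω]
        (V : ValuationSubring Ω), V.comap (algebraMap L₁ Ω) = O₁ →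
      (∀ z : Ω, IsAlgebraic L₁ z) →
      ∀ (Y : Finset Ω), (∀ y ∈ Y, IsSeparable k y) →
        (↑Y : Set Ω) ⊆ henselization V (algebraMap L₁ Ω).fieldRange →
      ∀ x : L₁, x ∈ O₁ → Transcendental k (algebraMap L₁ Ω x) →
        (algebraMap L₁ Ω).fieldRange ≤ henselization V
          (Subfield.closure (Set.range (algebraMap k Ω) ∪ ↑Y ∪ {algebraMap L₁ Ω x})) →
      Temkin2013RelativeCurveConclusion k K Ok O A L₁ O₁) :
    Temkin2013RelativeCurveSmoothFibre.{u} :=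
  Temkin2013RelativeCurveSmoothFibre.of_discProvider (fun _ _ _ _ _ _ _ => True)
    (fun _ _ _ _ _ _ _ _ _ _ _ _ _ _ _ _ S Y _ hSpi hYsep _ _ _ hYh _ =>
      ⟨S, Y, subset_rfl, subset_rfl, hSpi, hYsep, hYh, trivial⟩)
    (fun k K _ _ _ Ok O h1 h2 h3 h4 h5 h6 h7 h8 A hA hsm L₁ _ _ _ _ hL₁ O₁ hO₁ hsm₁ Ω _ _ _ _ _ _ _ _
        V hV halg Y hYsep hYh x hx hxtr hgen _ _ _ _ _ =>
      hJ2 k K Ok O h1 h2 h3 h4 h5 h6 h7 h8 A hA hsm L₁ hL₁ O₁ hO₁ hsm₁ Ω V hV halg Y hYsep hYh x hx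
        hxtr hgen)

/-- **`Temkin2013` from (J2) with `Ω` algebraic over `L₁`** (Thm. 1.3.2, weak absolute form).
[cite: Temkin2013, Thm. 1.3.2 with Thm. 3.3.1] -/
theorem Temkin2013.of_algebraization_of_isAlgebraic
    (hJ2 : ∀ (k K : Type u) [Field k] [Field K] [Algebra k K]
      (Ok : ValuationSubring k) (O : ValuationSubring K),
      ringChar (ResidueField Ok) = ringChar k →
      O.comap (algebraMap k K) = Ok → ringKrullDim Ok = 1 → ringKrullDim O = 1 →
      (⊤ : IntermediateField k K).FG → Algebra.trdeg k K = 1 →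
      IsValueTorsionOver O (algebraMap k K).fieldRange ⊤ →
      IsResiduallyAlgebraicOver O (algebraMap k K).fieldRange ⊤ →
      ∀ A : Subring K, IsAffineNormalizedModel O (Ok.toSubring.map (algebraMap k K)) A →
      Algebra.Smooth k (Algebra.adjoin k (A : Set K)) →
      ∀ (L₁ : Type u) [Field L₁] [Algebra K L₁] [Algebra k L₁] [IsScalarTower k K L₁],
      FiniteDimensional K L₁ →
      ∀ O₁ : ValuationSubring L₁, O₁.comap (algebraMap K L₁) = O →
      Algebra.Smooth k (Algebra.adjoin k (nrIn (A.map (algebraMap K L₁)) : Set L₁)) →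
      ∀ (Ω : Type u) [Field Ω] [IsAlgClosed Ω] [Algebra L₁ Ω] [Algebra K Ω] [Algebra k Ω]
        [IsScalarTower K L₁ Ω] [IsScalarTower k L₁ Ω] [IsScalarTower k K Ω]
        (V : ValuationSubring Ω), V.comap (algebraMap L₁ Ω) = O₁ →
      (∀ z : Ω, IsAlgebraic L₁ z) →
      ∀ (Y : Finset Ω), (∀ y ∈ Y, IsSeparable k y) →
        (↑Y : Set Ω) ⊆ henselization V (algebraMap L₁ Ω).fieldRange →
      ∀ x : L₁, x ∈ O₁ → Transcendental k (algebraMap L₁ Ω x) →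
        (algebraMap L₁ Ω).fieldRange ≤ henselization V
          (Subfield.closure (Set.range (algebraMap k Ω) ∪ ↑Y ∪ {algebraMap L₁ Ω x})) →
      Temkin2013RelativeCurveConclusion k K Ok O A L₁ O₁) :
    Temkin2013.{u} :=
  Temkin2013.of_smoothFibre (Temkin2013RelativeCurveSmoothFibre.of_algebraization_of_isAlgebraic hJ2)

/-! ### The level data with the constants of the algebraization (for a level passage INSIDE (J2)) -/

set_option maxHeartbeats 1600000 in
set_option synthInstance.maxHeartbeats 80000 in
/-- **The level data of Thm. 3.3.1 with the data of (J2) and extra constants.** The alternative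
to threading `Φ`: keep (J2) as stated and pass to a deeper level INSIDE its proof, after the
finitely many elements to be avoided by the disc are known. Data: the binders of (J2) — the data
and hypotheses of `Temkin2013RelativeCurveSmoothFibre` (its two smoothness hypotheses are not
needed), `(Ω, V) ⊇ (K₁, K₁°)` algebraically closed, `k`-separable constants `Y ⊆ K₁^h`, a
generator `x ∈ K₁°` transcendental over `k` with `K₁ ≤ k(Y)(x)^h` — together with a finite set
`S` of elements of the perfect closure of `k` in `Ω` and finitely many EXTRA constants `Y⁺`
(`Yp`), separable over `k(S)` and lying in `(K₁·k(S))^h` (e.g. the centre, the radius and the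
coefficients of the split-disc package of `GeneratorDeepCentres.lean` at the level `S`).
Conclusion: the level data of `exists_smoothFibre_level` over a finite purely inseparable level
`lvl ⊇ S` (all hypotheses of the fact re-established, smoothness of both normalized generic
fibres included, and the descent of the conclusion), AND the data of (J2) for the level: every
element of `Y ∪ Y⁺` (as a subset of `Ω`) is separable over the level field `l₀` (whose image in `Ω` is `lvl`) and lies
in the henselization of `F₁ = K₁·lvl`, and `x`, read in `F₁° = V ∩ F₁`, is transcendental over
`l₀` with `F₁ ≤ l₀(Y ∪ Y⁺)(x)^h`. [cite: Temkin2013, proof of Thm. 3.3.1, Steps 1–2; Thm. 3.2.6,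
proof, Step 2] -/
theorem exists_smoothFibre_level_with_constants (k K : Type u) [Field k] [Field K] [Algebra k K]
    (Ok : ValuationSubring k) (O : ValuationSubring K)
    (hchar : ringChar (ResidueField Ok) = ringChar k)
    (hOk : O.comap (algebraMap k K) = Ok) (hdimk : ringKrullDim Ok = 1)
    (hdimK : ringKrullDim O = 1) (hfg : (⊤ : IntermediateField k K).FG)
    (htr : Algebra.trdeg k K = 1) (hvt : IsValueTorsionOver O (algebraMap k K).fieldRange ⊤)
    (hra : IsResiduallyAlgebraicOver O (algebraMap k K).fieldRange ⊤)
    (A : Subring K) (hA : IsAffineNormalizedModel O (Ok.toSubring.map (algebraMap k K)) A)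
    (K₁ : Type u) [Field K₁] [Algebra K K₁] [Algebra k K₁] [IsScalarTower k K K₁]
    [FiniteDimensional K K₁] (O₁ : ValuationSubring K₁) (hO₁ : O₁.comap (algebraMap K K₁) = O)
    (Ω : Type u) [Field Ω] [IsAlgClosed Ω] [Algebra K₁ Ω] [Algebra K Ω] [Algebra k Ω]
    [IsScalarTower K K₁ Ω] [IsScalarTower k K₁ Ω] [IsScalarTower k K Ω]
    (V : ValuationSubring Ω) (hV : V.comap (algebraMap K₁ Ω) = O₁)
    (Y : Finset Ω) (hYsep : ∀ y ∈ Y, IsSeparable k y)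
    (hYh : (↑Y : Set Ω) ⊆ henselization V (algebraMap K₁ Ω).fieldRange)
    (x : K₁) (hx : x ∈ O₁) (hxtr : Transcendental k (algebraMap K₁ Ω x))
    (hgen : (algebraMap K₁ Ω).fieldRange ≤ henselization V
      (Subfield.closure (Set.range (algebraMap k Ω) ∪ ↑Y ∪ {algebraMap K₁ Ω x})))
    (S : Finset Ω) (hS : (↑S : Set Ω) ⊆ perfectClosure k Ω)
    (Yp : Finset Ω)
    (hYpsep : ∀ y ∈ Yp, IsSeparable (Subfield.closure (Set.range (algebraMap k Ω) ∪ ↑S)) y)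
    (hYph : (↑Yp : Set Ω) ⊆ henselization V
      ((algebraMap K₁ Ω).fieldRange ⊔ Subfield.closure (Set.range (algebraMap k Ω) ∪ ↑S))) :
    ∃ (lvl : IntermediateField k Ω), (↑S : Set Ω) ⊆ lvl ∧ lvl ≤ perfectClosure k Ω ∧
      FiniteDimensional k lvl ∧
    ∃ (FE FE₁ : IntermediateField k Ω),
      FE = (IsScalarTower.toAlgHom k K Ω).fieldRange ⊔ lvl ∧
      FE₁ = (IsScalarTower.toAlgHom k K₁ Ω).fieldRange ⊔ lvl ∧
    ∃ (hle : FE ≤ FE₁) (_ : Algebra K FE) (_ : IsScalarTower k K FE) (_ : Algebra K₁ FE₁)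
      (_ : IsScalarTower k K₁ FE₁) (_ : Algebra K FE₁) (_ : IsScalarTower K K₁ FE₁),
      (∀ z : K, ((algebraMap K FE z : FE) : Ω) = algebraMap K Ω z) ∧
      (∀ z : K₁, ((algebraMap K₁ FE₁ z : FE₁) : Ω) = algebraMap K₁ Ω z) ∧
      (letI : Algebra FE FE₁ := (IntermediateField.inclusion hle).toRingHom.toAlgebra
       IsScalarTower K FE FE₁ ∧ FiniteDimensional FE FE₁) ∧
      FiniteDimensional K FE ∧ IsPurelyInseparable K FE ∧
      FiniteDimensional K₁ FE₁ ∧ IsPurelyInseparable K₁ FE₁ ∧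
    ∃ (l₀ : IntermediateField k FE),
      (∀ x : FE, x ∈ l₀ ↔ (x : Ω) ∈ lvl) ∧ FiniteDimensional k l₀ ∧ IsPurelyInseparable k l₀ ∧
      Algebra.adjoin K (l₀ : Set FE) = ⊤ ∧
      (letI : Algebra FE FE₁ := (IntermediateField.inclusion hle).toRingHom.toAlgebra
       Algebra.adjoin K₁ (Set.range (algebraMap l₀ FE₁)) = ⊤) ∧
    -- the valuation rings induced by `V` and the model
    ∃ (A_F : Subring FE), A.map (algebraMap K FE) ≤ A_F ∧
      (letI : Algebra FE FE₁ := (IntermediateField.inclusion hle).toRingHom.toAlgebra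
       let O_F₁ : ValuationSubring FE₁ := V.comap (algebraMap FE₁ Ω)
       let O_F : ValuationSubring FE := O_F₁.comap (algebraMap FE FE₁)
       let Ol₀ : ValuationSubring l₀ := O_F.comap (algebraMap l₀ FE)
       O_F₁.comap (algebraMap K₁ FE₁) = O₁ ∧ O_F.comap (algebraMap K FE) = O ∧
       O_F = V.comap (algebraMap FE Ω) ∧ Ol₀.comap (algebraMap k l₀) = Ok ∧
       -- the hypotheses of the fact for the level data
       ringChar (ResidueField Ol₀) = ringChar l₀ ∧ ringKrullDim Ol₀ = 1 ∧ ringKrullDim O_F = 1 ∧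
       (⊤ : IntermediateField l₀ FE).FG ∧ Algebra.trdeg l₀ FE = 1 ∧
       IsValueTorsionOver O_F (algebraMap l₀ FE).fieldRange ⊤ ∧
       IsResiduallyAlgebraicOver O_F (algebraMap l₀ FE).fieldRange ⊤ ∧
       IsAffineNormalizedModel O_F (Ol₀.toSubring.map (algebraMap l₀ FE)) A_F ∧
       Algebra.Smooth l₀ (Algebra.adjoin l₀ (A_F : Set FE)) ∧
       Algebra.Smooth l₀ (Algebra.adjoin l₀ (nrIn (A_F.map (algebraMap FE FE₁)) : Set FE₁)) ∧
       -- Step 1: the conclusion descends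
       (Temkin2013RelativeCurveConclusion l₀ FE Ol₀ O_F A_F FE₁ O_F₁ →
          Temkin2013RelativeCurveConclusion k K Ok O A K₁ O₁) ∧
       -- the data of (J2) for the level, with the extra constants
       Set.range (algebraMap l₀ Ω) = (lvl : Set Ω) ∧
       (∀ y ∈ (↑Y ∪ ↑Yp : Set Ω), IsSeparable l₀ y) ∧
       (↑Y ∪ ↑Yp : Set Ω) ⊆ henselization V (algebraMap FE₁ Ω).fieldRange ∧
       ∃ x₁ : FE₁, (x₁ : Ω) = algebraMap K₁ Ω x ∧ x₁ ∈ O_F₁ ∧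
         Transcendental l₀ (algebraMap FE₁ Ω x₁) ∧
         (algebraMap FE₁ Ω).fieldRange ≤ henselization V
           (Subfield.closure (Set.range (algebraMap l₀ Ω) ∪ (↑Y ∪ ↑Yp) ∪ {algebraMap FE₁ Ω x₁}))) := by
  classical
  have hhens := Kuhlmann2010HenselizationIsHenselian_holds.{u}
  ------------------------------------------------------------------
  -- ### the level data (Step 1)
  ------------------------------------------------------------------
  obtain ⟨lvl, hSlvl, hlvlk, hlvlfin, FE, FE₁, hFE, hFE₁, hFEle, iKFE, iTk, iK₁FE₁, iTk₁, iKFE₁,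
    iT₁, hψ, hψ₁, hTfin, hFfin, hFpi, hF₁fin, hF₁pi, l₀, hl₀mem, hl₀fin, hl₀pi, hFgen, hF₁gen,
    A_F, hAA_F, hrest⟩ :=
    exists_smoothFibre_level k K Ok O hchar hOk hdimk hdimK hfg htr hvt hra A hA K₁ O₁ hO₁ Ω V hV
      S hS
  letI := iKFE; letI := iK₁FE₁; letI := iKFE₁
  haveI := iTk; haveI := iTk₁; haveI := iT₁
  letI iFF₁ : Algebra FE FE₁ := (IntermediateField.inclusion hFEle).toRingHom.toAlgebra
  obtain ⟨iT₂, h10⟩ := hTfin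
  haveI := iT₂; haveI := hl₀fin
  obtain ⟨hO_F₁K₁, hO_FK, hO_Feq, hOk', h1, h3, h4, h5, h6, h7, h8, h9, hsmF, hsmF₁, htransport⟩ :=
    hrest
  -- instances towards `Ω`
  haveI : IsScalarTower FE FE₁ Ω := IsScalarTower.of_algebraMap_eq fun _ => rfl
  haveI : IsScalarTower l₀ FE₁ Ω := IsScalarTower.of_algebraMap_eq fun _ => rfl
  haveI : IsScalarTower l₀ FE Ω := IsScalarTower.of_algebraMap_eq fun _ => rfl
  haveI : IsScalarTower k l₀ Ω := IsScalarTower.of_algebraMap_eq fun _ => rfl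
  -- the image of `l₀` in `Ω` is `lvl`
  have hl₀range : Set.range (algebraMap l₀ Ω) = (lvl : Set Ω) := by
    ext z
    constructor
    · rintro ⟨c, rfl⟩
      exact (hl₀mem (c : FE)).mp c.2
    · intro hz
      have hzFE : z ∈ FE := by
        rw [hFE]; exact (le_sup_right : lvl ≤ _ ⊔ lvl) hz
      exact ⟨⟨⟨z, hzFE⟩, (hl₀mem _).mpr hz⟩, rfl⟩
  -- `kΩ ∪ S ⊆ lvl`, so `k(S) ≤ lvl`
  have hkl : Set.range (algebraMap k Ω) ⊆ (lvl : Set Ω) := by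
    rintro _ ⟨c, rfl⟩
    exact lvl.algebraMap_mem c
  have hkS_lvl : Subfield.closure (Set.range (algebraMap k Ω) ∪ ↑S) ≤ lvl.toSubfield :=
    Subfield.closure_le.mpr (Set.union_subset hkl hSlvl)
  -- the range of `F₁ = K₁·lvl` in `Ω`
  have hF₁range : (algebraMap FE₁ Ω).fieldRange = FE₁.toSubfield :=
    fieldRange_algebraMap_intermediateField FE₁
  have hK₁FE₁ : (algebraMap K₁ Ω).fieldRange ≤ FE₁.toSubfield := by
    rintro _ ⟨z, rfl⟩
    rw [hFE₁]
    exact (le_sup_left : (IsScalarTower.toAlgHom k K₁ Ω).fieldRange ≤ _) ⟨z, rfl⟩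
  have hlvlFE₁ : lvl ≤ FE₁ := by rw [hFE₁]; exact le_sup_right
  have hK₁S_FE₁ : (algebraMap K₁ Ω).fieldRange ⊔
      Subfield.closure (Set.range (algebraMap k Ω) ∪ ↑S) ≤ FE₁.toSubfield :=
    sup_le hK₁FE₁ (hkS_lvl.trans fun z hz => hlvlFE₁ hz)
  ------------------------------------------------------------------
  -- ### the data of (J2) for the level
  ------------------------------------------------------------------
  -- the constants are separable over `l₀`
  have hYsep' : ∀ y ∈ (↑Y ∪ ↑Yp : Set Ω), IsSeparable l₀ y := by
    intro y hy
    rcases hy with hy | hy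
    · exact IsSeparable.tower_top l₀ (hYsep y hy)
    · exact isSeparable_of_subfield_le_range l₀ _ (fun z hz => by
        rw [hl₀range]; exact hkS_lvl hz) (hYpsep y hy)
  -- the constants lie in the henselization of `F₁`
  have hYh' : (↑Y ∪ ↑Yp : Set Ω) ⊆ henselization V (algebraMap FE₁ Ω).fieldRange := by
    rw [hF₁range]
    refine Set.union_subset ?_ ?_
    · exact hYh.trans (henselization_mono V hhens hK₁FE₁)
    · exact hYph.trans (henselization_mono V hhens hK₁S_FE₁)
  -- the generator as an element of `F₁°`
  have hxFE₁ : algebraMap K₁ Ω x ∈ FE₁ := hK₁FE₁ ⟨x, rfl⟩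
  let x₁ : FE₁ := ⟨algebraMap K₁ Ω x, hxFE₁⟩
  have hx₁Ω : algebraMap FE₁ Ω x₁ = algebraMap K₁ Ω x := rfl
  have hx₁O : x₁ ∈ V.comap (algebraMap FE₁ Ω) := by
    show algebraMap K₁ Ω x ∈ V
    rw [← ValuationSubring.mem_comap, hV]; exact hx
  -- transcendence over `l₀` (`l₀` is finite over `k`)
  have hx₁tr : Transcendental l₀ (algebraMap FE₁ Ω x₁) := by
    rw [hx₁Ω]
    intro halg
    haveI : Algebra.IsIntegral k l₀ := Algebra.IsIntegral.of_finite k l₀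
    exact hxtr (isIntegral_trans _ halg.isIntegral).isAlgebraic
  -- the E-side inclusion `F₁ ≤ l₀(Y ∪ Y⁺)(x)^h`
  have hE : (algebraMap FE₁ Ω).fieldRange ≤ henselization V
      (Subfield.closure (Set.range (algebraMap l₀ Ω) ∪ (↑Y ∪ ↑Yp) ∪ {algebraMap FE₁ Ω x₁})) := by
    rw [hF₁range, hx₁Ω, hl₀range]
    have hFE₁eq : FE₁.toSubfield = (algebraMap K₁ Ω).fieldRange ⊔ lvl.toSubfield := by
      apply le_antisymm
      · intro z hz
        rw [hFE₁] at hz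
        have : (IsScalarTower.toAlgHom k K₁ Ω).fieldRange ⊔ lvl ≤
            ((algebraMap K₁ Ω).fieldRange ⊔ lvl.toSubfield).toIntermediateField
              (fun c => (le_sup_right : lvl.toSubfield ≤ _) (lvl.algebraMap_mem c)) := by
          refine sup_le ?_ ?_
          · rintro _ ⟨w, rfl⟩
            exact (le_sup_left : (algebraMap K₁ Ω).fieldRange ≤ _) ⟨w, rfl⟩
          · intro w hw
            exact (le_sup_right : lvl.toSubfield ≤ _) hw
        exact this hz
      · exact sup_le hK₁FE₁ fun z hz => hlvlFE₁ hz
    rw [hFE₁eq]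
    refine sup_le ?_ ?_
    · refine hgen.trans (henselization_mono V hhens (Subfield.closure_mono ?_))
      refine Set.union_subset_union_left _ (Set.union_subset_union hkl ?_)
      exact Set.subset_union_left
    · intro z hz
      exact le_henselization V _ (Subfield.subset_closure (Or.inl (Or.inl hz)))
  ------------------------------------------------------------------
  -- ### assemble
  ------------------------------------------------------------------
  exact ⟨lvl, hSlvl, hlvlk, hlvlfin, FE, FE₁, hFE, hFE₁, hFEle, iKFE, iTk, iK₁FE₁, iTk₁, iKFE₁,
    iT₁, hψ, hψ₁, ⟨iT₂, h10⟩, hFfin, hFpi, hF₁fin, hF₁pi, l₀, hl₀mem, hl₀fin, hl₀pi, hFgen,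
    hF₁gen, A_F, hAA_F, hO_F₁K₁, hO_FK, hO_Feq, hOk', h1, h3, h4, h5, h6, h7, h8, h9, hsmF,
    hsmF₁, htransport, hl₀range, hYsep', hYh', x₁, rfl, hx₁O, hx₁tr, hE⟩

end Literature.AlgebraicGeometry.Resolution

end
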